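import Summits.ResolutionOfSingularities.ResolutionOfSingularities.Theorems.PurelyInseparableDim4NearDimConverseCentre
import Summits.ResolutionOfSingularities.ResolutionOfSingularities.Theorems.PurelyInseparableDim4IsolationCert
import Mathlib.FieldTheory.Finite.GaloisField
import HarnessLib

/-!
# [OURS · res-dim4-pi PR-3e] The FINITE-FIELD CAVEAT for `near_dim`: over `𝔽₄` every point of an exceptional
  hyperplane can be near although the state is NOT in the LOCUS class `ord_{C_S} F ≥ 2p` — the converse of
  PR-3 (PR-3c/3d) needs an infinite field

Cell `res-dim4-pi` (D-0157 DOOR 2), seat `res-dim4-p-3`; sequel of `PurelyInseparableDim4NearDimConverseCentre`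
(`forall_isEquimultiplePoint_centre_iff_two_mul_le_ordAlong`, INFINITE field).  The engines read near points over
`𝔽_p` / `𝔽_{p²}` (`s_detect ≤ 2`, WORD #10 / #12); this file shows by a kernel specimen that such a count can
report «all points near» (`near_dim = n − 1`) on a state that is NOT `LOCUS`.

## The specimen (class `(4, 1)`, `p = 2`)

`F = x₁x₂x₄⁸ + x₁x₂x₄²` (clean: odd exponents), centre `S = {x₁, x₂}` (`ord_{(x₁,x₂)} F = 2 = p`, HP-(1)
permissible, `< 2p`), chart `x₁`: the chart transform is `x₂(x₄⁸ + x₄²)`, and at a point `b` (`b₁ = 0`) of the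
exceptional hyperplane the translate is `(x₂ + b₂)((x₄ + b₄)⁸ + (x₄ + b₄)²) = (x₂ + b₂)(x₄⁸ + x₄² + (b₄⁸ + b₄²))`
(characteristic `2`).  If `b₄⁴ = b₄` — every `b₄ ∈ 𝔽₄` — then `b₄⁸ + b₄² = 0` and NO monomial of degree `1`
survives: the point is equimultiple.  If `b₄⁴ ≠ b₄` (possible over `𝔽₁₆`, forced somewhere over an infinite
field by PR-3d) the term `(b₄⁴ + b₄)²·x₂` has degree `1 < 2`: NOT equimultiple.

* `specimen_clean`, `ordAlong_specimen` (`= 2`), `coeff_single_pointTransform_specimen` (the four linear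
  coefficients at `b`), **`isEquimultiplePoint_specimen_of_pow_four_eq`** (`b₁ = 0`, `b₄⁴ = b₄ ⇒` near, any
  char-`2` field), **`forall_isEquimultiplePoint_specimen_galoisField`** (over `𝔽₄ = GaloisField 2 2`: EVERY `b`
  with `b₁ = 0` is near), **`exists_not_isEquimultiplePoint_specimen`** (over any INFINITE field of char `2`
  some `b` is not — PR-3d), and the headline **`nearDim_finiteField_caveat`** (both at once).

Census reading: «near_dim = n − 1» computed from `𝔽_{p^k}`-rational near points does NOT certify LOCUS; the
certificate is PR-3's exponent test (every monomial of the cleaned `F` has `Σ_{i∈S} dᵢ ≥ 2p`), which is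
field-independent.  [OURS · counted 0 · kernel specimen; AI kernel work, weaker than expert review.]  Nothing
here is a statement about resolution of singularities; resolution in dimension `≥ 4` / characteristic
`p > 0` is NOT proved by anything in this file.  Host item (DR-157-C): `stmt-ResolutionOfSingularities-16155`,
helper.
-/

noncomputable section

set_option linter.dupNamespace false -- mandated namespace of this single-conjunct summit

open MvPolynomial Finset
open scoped BigOperators

namespace Summit.ResolutionOfSingularities.ResolutionOfSingularities.Theorems.PIDim4.NearDim

open Literature.AlgebraicGeometry.Resolution
open Literature.AlgebraicGeometry.Resolution.CentreBlowup
open Literature.AlgebraicGeometry.Resolution.Hauser2010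

/-- The exponents of the specimen `F = x₁x₂x₄⁸ + x₁x₂x₄²` (variables `x₁..x₄ = X 0..X 3`). [folklore] -/
private theorem specimen_eq (K : Type) [CommRing K] :
    (X 0 * X 1 * X 3 ^ 8 + X 0 * X 1 * X 3 ^ 2 : MvPolynomial (Fin 4) K) =
      monomial (Finsupp.single 0 1 + Finsupp.single 1 1 + Finsupp.single 3 8) 1 +
        monomial (Finsupp.single 0 1 + Finsupp.single 1 1 + Finsupp.single 3 2) 1 := by
  simp only [X, monomial_mul, monomial_pow, one_pow, mul_one, Finsupp.smul_single, smul_eq_mul]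

/-- The two exponents are distinct. [folklore] -/
private theorem specimen_exponents_ne :
    (Finsupp.single 0 1 + Finsupp.single 1 1 + Finsupp.single 3 8 : Fin 4 →₀ ℕ) ≠
      Finsupp.single 0 1 + Finsupp.single 1 1 + Finsupp.single 3 2 := by
  intro h
  have := DFunLike.congr_fun h 3
  simp [Finsupp.add_apply] at this

/-- **The specimen is CLEAN** at `p = 2` (both monomials have an odd exponent). OURS (bookkeeping).
[cite: Hauser2010, §G (cleaning of p-th power monomials)] -/
theorem specimen_clean (K : Type) [CommRing K] :
    deletePthPowers 2 (X 0 * X 1 * X 3 ^ 8 + X 0 * X 1 * X 3 ^ 2 : MvPolynomial (Fin 4) K) =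
      X 0 * X 1 * X 3 ^ 8 + X 0 * X 1 * X 3 ^ 2 := by
  have h1 : ¬ IsPthPowerExponent 2
      (Finsupp.single 0 1 + Finsupp.single 1 1 + Finsupp.single 3 8 : Fin 4 →₀ ℕ) := by
    intro h
    have := (isPthPowerExponent_iff 2 _).mp h 0
    simp [Finsupp.add_apply] at this
  have h2 : ¬ IsPthPowerExponent 2
      (Finsupp.single 0 1 + Finsupp.single 1 1 + Finsupp.single 3 2 : Fin 4 →₀ ℕ) := by
    intro h
    have := (isPthPowerExponent_iff 2 _).mp h 0
    simp [Finsupp.add_apply] at this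
  rw [specimen_eq, deletePthPowers_add, deletePthPowers_monomial, deletePthPowers_monomial, if_neg h1,
    if_neg h2]

/-- **`ord_{(x₁,x₂)} F = 2`** (`= p`, `< 2p = 4`): the centre `V(z, x₁, x₂)` is HP-(1)-permissible but the state
is NOT in PR-3's LOCUS class. OURS (bookkeeping). [cite: HauserPerlega2019PRIMS, §2 (ord_P)] -/
theorem ordAlong_specimen (K : Type) [Field K] :
    ordAlong ({0, 1} : Finset (Fin 4)) (X 0 * X 1 * X 3 ^ 8 + X 0 * X 1 * X 3 ^ 2 : MvPolynomial (Fin 4) K)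
      = 2 := by
  rw [specimen_eq, ordAlong_monomial_add_monomial _ specimen_exponents_ne one_ne_zero one_ne_zero]
  simp [degIn, Finsupp.add_apply, Finsupp.single_apply]

/-- **The linear coefficients of the transform at `b` (`b₁ = 0`) in the chart `x₁` over `C_{x₁,x₂}`**:
`coeff_{e_i} = Σ_{E} ∏ₖ C(E_k, δ_{ik}) b_k^{E_k − δ_{ik}}` over the two chart exponents `E = (0,1,0,8), (0,1,0,2)`;
explicitly `0, b₄⁸ + b₄², 0, 8b₂b₄⁷ + 2b₂b₄`. OURS (bookkeeping; tree `WeightedBlowup.coeff_translate_monomial`).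
[cite: Hauser2010, §F (chart expressions of a point blowup)] -/
theorem coeff_single_pointTransform_specimen {K : Type} [Field K] (b : Fin 4 → K) (hb0 : b 0 = 0)
    (r : Fin 4 →₀ ℕ) (exc : Finset (Fin 4)) (i : Fin 4) :
    coeff (Finsupp.single i 1) (pointTransform 2 ({0, 1} : Finset (Fin 4)) 0 b
      ⟨X 0 * X 1 * X 3 ^ 8 + X 0 * X 1 * X 3 ^ 2, r, exc⟩) =
      if i = 1 then b 3 ^ 8 + b 3 ^ 2 else if i = 3 then 8 * b 1 * b 3 ^ 7 + 2 * b 1 * b 3 else 0 := by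
  have hct : chartTransform 2 ({0, 1} : Finset (Fin 4)) 0
      (X 0 * X 1 * X 3 ^ 8 + X 0 * X 1 * X 3 ^ 2 : MvPolynomial (Fin 4) K) =
      monomial (Finsupp.single 1 1 + Finsupp.single 3 8) 1 + monomial (Finsupp.single 1 1 + Finsupp.single 3 2) 1 := by
    have hE1 : chartExponent 2 ({0, 1} : Finset (Fin 4)) 0
        (Finsupp.single 0 1 + Finsupp.single 1 1 + Finsupp.single 3 8 : Fin 4 →₀ ℕ) =
        Finsupp.single 1 1 + Finsupp.single 3 8 := by
      rw [chartExponent_eq_iff]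
      refine ⟨?_, fun k hk => ?_⟩
      · simp [degIn, Finsupp.add_apply, Finsupp.single_apply]
      · fin_cases k <;> simp_all [Finsupp.add_apply]
    have hE2 : chartExponent 2 ({0, 1} : Finset (Fin 4)) 0
        (Finsupp.single 0 1 + Finsupp.single 1 1 + Finsupp.single 3 2 : Fin 4 →₀ ℕ) =
        Finsupp.single 1 1 + Finsupp.single 3 2 := by
      rw [chartExponent_eq_iff]
      refine ⟨?_, fun k hk => ?_⟩
      · simp [degIn, Finsupp.add_apply, Finsupp.single_apply]
      · fin_cases k <;> simp_all [Finsupp.add_apply]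
    rw [specimen_eq, chartTransform_monomial_add_monomial, hE1, hE2]
  unfold pointTransform
  simp only
  rw [hct]
  unfold PointBlowup.translate
  rw [map_add]
  change coeff (Finsupp.single i 1) (PointBlowup.translate b (monomial _ 1) +
    PointBlowup.translate b (monomial _ 1)) = _
  rw [coeff_add, WeightedBlowup.coeff_translate_monomial, WeightedBlowup.coeff_translate_monomial,
    one_mul, one_mul, Fin.prod_univ_four, Fin.prod_univ_four]
  fin_cases i
  all_goals simp [Finsupp.add_apply, hb0]
  all_goals ring

/-- **Every point with `b₄ ∈ 𝔽₄` is near.** Over any field of characteristic `2`: if `b₁ = 0` and `b₄⁴ = b₄`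
then `b` is an equimultiple point of the chart `x₁` of `Bl_{C_{x₁,x₂}}` for the specimen (`b₄⁸ + b₄² =
(b₄⁴)² + b₄² = 2b₄² = 0`; `8 = 2 = 0`). OURS (kernel specimen). [cite: Hauser2010, §F (equiconstant points)] -/
theorem isEquimultiplePoint_specimen_of_pow_four_eq {K : Type} [Field K] [CharP K 2] (b : Fin 4 → K)
    (hb0 : b 0 = 0) (hb3 : b 3 ^ 4 = b 3) (r : Fin 4 →₀ ℕ) (exc : Finset (Fin 4)) :
    IsEquimultiplePoint 2 ({0, 1} : Finset (Fin 4)) 0 b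
      ⟨X 0 * X 1 * X 3 ^ 8 + X 0 * X 1 * X 3 ^ 2, r, exc⟩ := by
  intro d hd0 hd2
  obtain ⟨i, rfl⟩ := IsolationCert.exists_eq_single_of_degree_eq_one (γ := d) (by
    have : d.degree ≠ 0 := fun h => hd0 ((Finsupp.degree_eq_zero_iff d).mp h)
    omega)
  rw [coeff_single_pointTransform_specimen b hb0]
  have h2 : (2 : K) = 0 := by
    have := CharP.cast_eq_zero K 2
    simpa using this
  have h8 : (8 : K) = 0 := by
    have : (8 : K) = 2 * 4 := by norm_num
    rw [this, h2, zero_mul]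
  have hb38 : b 3 ^ 8 = b 3 ^ 2 := by
    calc b 3 ^ 8 = (b 3 ^ 4) ^ 2 := by ring
      _ = b 3 ^ 2 := by rw [hb3]
  split_ifs
  · rw [hb38, ← two_mul, h2, zero_mul]
  · rw [h8, h2]; ring
  · rfl

/-- **Over `𝔽₄` EVERY point of the exceptional hyperplane is near** (`b₄⁴ = b₄` for all `b₄ ∈ 𝔽₄`): the
rational near-point count reports `near_dim = 3` on this NON-LOCUS state. OURS (kernel specimen).
[cite: Hauser2010, §F (equiconstant points)] -/
theorem forall_isEquimultiplePoint_specimen_galoisField (r : Fin 4 →₀ ℕ) (exc : Finset (Fin 4))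
    (b : Fin 4 → GaloisField 2 2) (hb0 : b 0 = 0) :
    IsEquimultiplePoint 2 ({0, 1} : Finset (Fin 4)) 0 b
      ⟨X 0 * X 1 * X 3 ^ 8 + X 0 * X 1 * X 3 ^ 2, r, exc⟩ := by
  classical
  haveI : Fintype (GaloisField 2 2) := Fintype.ofFinite _
  have hcard : Fintype.card (GaloisField 2 2) = 4 := by
    rw [← Nat.card_eq_fintype_card, GaloisField.card 2 2 two_ne_zero]; norm_num
  have h4 : b 3 ^ Fintype.card (GaloisField 2 2) = b 3 := FiniteField.pow_card (b 3)
  rw [hcard] at h4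
  exact isEquimultiplePoint_specimen_of_pow_four_eq b hb0 h4 r exc

/-- **… yet over an INFINITE field of characteristic `2` some point is NOT near** (PR-3d, `ord_S F = p`, clean).
OURS. [cite: Hauser2010, §F (equiconstant points)] -/
theorem exists_not_isEquimultiplePoint_specimen {K : Type} [Field K] [CharP K 2] [Infinite K]
    (r : Fin 4 →₀ ℕ) (exc : Finset (Fin 4)) :
    ∃ b : Fin 4 → K, b 0 = 0 ∧ ¬ IsEquimultiplePoint 2 ({0, 1} : Finset (Fin 4)) 0 b
      ⟨X 0 * X 1 * X 3 ^ 8 + X 0 * X 1 * X 3 ^ 2, r, exc⟩ :=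
  haveI : Fact (Nat.Prime 2) := ⟨Nat.prime_two⟩
  exists_not_isEquimultiplePoint_centre_of_ordAlong_eq 2 (by simp) _
    (by exact_mod_cast ordAlong_specimen K) (specimen_clean K)

/-- **THE FINITE-FIELD CAVEAT (PR-3e).** For the clean state `F = x₁x₂x₄⁸ + x₁x₂x₄²`, centre `C_{x₁,x₂}`
(`ord = 2 = p < 2p`), chart `x₁`: over `𝔽₄` every point of the exceptional hyperplane is equimultiple, while over
any infinite field of characteristic `2` some point is not.  So «all `𝔽_{p²}`-rational points near» does NOT
imply PR-3's LOCUS condition `ord_{C_S} F ≥ 2p`; only the exponent test does. OURS (census caveat for the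
`near_dim` column). [cite: Hauser2010, §F (equiconstant points)] -/
theorem nearDim_finiteField_caveat (r : Fin 4 →₀ ℕ) (exc : Finset (Fin 4)) :
    (∀ b : Fin 4 → GaloisField 2 2, b 0 = 0 →
        IsEquimultiplePoint 2 ({0, 1} : Finset (Fin 4)) 0 b
          ⟨X 0 * X 1 * X 3 ^ 8 + X 0 * X 1 * X 3 ^ 2, r, exc⟩) ∧
      ordAlong ({0, 1} : Finset (Fin 4))
          (X 0 * X 1 * X 3 ^ 8 + X 0 * X 1 * X 3 ^ 2 : MvPolynomial (Fin 4) (GaloisField 2 2)) = 2 ∧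
      ∀ (K : Type) [Field K] [CharP K 2] [Infinite K],
        ∃ b : Fin 4 → K, b 0 = 0 ∧ ¬ IsEquimultiplePoint 2 ({0, 1} : Finset (Fin 4)) 0 b
          ⟨X 0 * X 1 * X 3 ^ 8 + X 0 * X 1 * X 3 ^ 2, r, exc⟩ :=
  ⟨fun b hb0 => forall_isEquimultiplePoint_specimen_galoisField r exc b hb0, ordAlong_specimen _,
    fun K _ _ _ => exists_not_isEquimultiplePoint_specimen (K := K) r exc⟩

end Summit.ResolutionOfSingularities.ResolutionOfSingularities.Theorems.PIDim4.NearDim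

end
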